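import Mathlib
import Summits.Ventures.PercRepro2.TB14CutCase1
import Summits.Ventures.PercRepro2.TypedBHKHalf

/-!
# Typed BHK 1.4 across a cut vertex, II: the marks on one side, or crossed
(blind cell PercRepro2, mine-c g15, 2026-08-25; `conjectures/MINE-C.md` §24,
`proofs/MINEC-TB14BLOCK.md` §2, cases 2–4)

`c` is an unmarked cut vertex separating `a₁` (side `VA`) from `a₂` (side `VB`).  With
`s = (c ∈ C(a₁), c ∈ C'(a₁))` read on `VA` and `t = (c ∈ C(a₂), c ∈ C'(a₂))` read on `VB`
(`iQ_eq_cut`), every mark event is a product of side events (`iL_cross`, `iH_cross`), and the (TB14)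
slack `D = N(Q∩B, Q∩A) − N(Q∩A∩B, Q)` (`tb14_slack_eq`) is a bilinear form in side counts:

* `b, o ∈ VB` (`tb14_of_cut_sideB`): `D = N_A(c ∈ C∖C') · HALF_B + N_A(c ∈ C∩C') · D_B`, where
  `HALF_B ≥ 0` is p5's half-conditioned theorem on the side `B` with roots `(c, a₂)`
  (`TypedBHKHalf.pairCount_half`) and `D_B` is the (TB14) slack of the side `B` with roots `(c, a₂)`;
* `b, o ∈ VA` (`tb14_of_cut_sideA`): `D = N_B(c ∈ C'∖C) · MHALF_A + N_B(c ∈ C∩C') · D_A`, with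
  `MHALF_A ≥ 0` the mirror half form on the side `A` (`pairCount_half` with roots `(c, a₁)` and the
  marks `(o, b)`) and `D_A` the (TB14) slack of the side `A` with roots `(a₁, c)`;
* `b ∈ VB, o ∈ VA` (`tb14_of_cut_crossed`): `D = N_A(c ∈ C∖C', o ∈ C'(c)) · N_B(c ∈ C'∖C, b ∈ C(c)) ≥ 0`.

So typed BHK 1.4 on an instance with a root-separating cut vertex follows from typed BHK 1.4 on
the two sides (`tb14_of_cut`), unconditionally in the crossed and opposite cases.  Own work;
standard axioms.
-/

namespace Summit.Ventures.PercRepro2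

namespace TB14Cut

open CovForm A3InactiveTyped CutV

/-! ## Indicator algebra -/

section Algebra

variable {V : Type*} {E : Type*} {R : Type*} [Field R]

/-- `iH` and `iL` are the same connection indicator. -/
lemma iH_eq_iL (ends : E → Sym2 V) (a v : V) : (iH ends a v : Config E → R) = iL ends a v := rfl

/-- A connection indicator is idempotent. -/
lemma iL_mul_self (ends : E → Sym2 V) (a v : V) (y : Config E) :
    (iL ends a v y : R) * iL ends a v y = iL ends a v y := by
  classical
  rw [iL_eq_ite']
  split_ifs <;> simp

/-- A connection indicator is nonnegative. -/
lemma iL_nonneg'' [LinearOrder R] [IsStrictOrderedRing R] (ends : E → Sym2 V) (a v : V)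
    (y : Config E) : (0 : R) ≤ iL ends a v y := by
  classical
  rw [iL_eq_ite']
  split_ifs <;> norm_num

/-- A connection indicator is at most one. -/
lemma iL_le_one [LinearOrder R] [IsStrictOrderedRing R] (ends : E → Sym2 V) (a v : V)
    (y : Config E) : (iL ends a v y : R) ≤ 1 := by
  classical
  rw [iL_eq_ite']
  split_ifs <;> norm_num

/-- `1_Q = 1 − 1[a₂ ∈ C(a₁)]`. -/
lemma iQ_eq_one_sub_iL (ends : E → Sym2 V) (a₁ a₂ : V) (y : Config E) :
    (iQ ends a₁ a₂ y : R) = 1 - iL ends a₁ a₂ y := by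
  classical
  rw [iQ_eq_ite', iL_eq_ite']
  split_ifs <;> simp

/-- `1_Q = 1 − 1[a₁ ∈ C(a₂)]`. -/
lemma iQ_eq_one_sub_iH (ends : E → Sym2 V) (a₁ a₂ : V) (y : Config E) :
    (iQ ends a₁ a₂ y : R) = 1 - iH ends a₂ a₁ y := by
  classical
  rw [iQ_eq_ite', iH_eq_ite']
  by_cases h : Conn ends y a₁ a₂
  · rw [if_pos h, if_pos (conn_symm h)]
    simp
  · rw [if_neg h, if_neg (fun h' => h (conn_symm h'))]
    simp

/-- `1_Q` is symmetric in the two roots. -/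
lemma iQ_symm' (ends : E → Sym2 V) (a₁ a₂ : V) (y : Config E) :
    (iQ ends a₂ a₁ y : R) = iQ ends a₁ a₂ y := by
  classical
  rw [iQ_eq_ite', iQ_eq_ite']
  by_cases h : Conn ends y a₁ a₂
  · rw [if_pos h, if_pos (conn_symm h)]
  · rw [if_neg h, if_neg (fun h' => h (conn_symm h'))]

/-- `c` in both clusters contradicts `Q`: `1_Q · 1[c ∈ C(a₁)] · 1[c ∈ C(a₂)] = 0`. -/
lemma iQ_mul_both_eq_zero (ends : E → Sym2 V) (a₁ a₂ c : V) (y : Config E) :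
    (iQ ends a₁ a₂ y : R) * iL ends a₁ c y * iH ends a₂ c y = 0 := by
  classical
  rw [iQ_eq_ite', iL_eq_ite', iH_eq_ite']
  by_cases h1 : Conn ends y a₁ c <;> by_cases h2 : Conn ends y a₂ c <;> simp [h1, h2]
  exact conn_trans h1 (conn_symm h2)

end Algebra

section Counts

variable {V : Type} {E : Type} [Fintype E] [DecidableEq E] {R : Type*} [Field R] [LinearOrder R]
  [IsStrictOrderedRing R]

/-- A two-copy count of a nonnegative kernel is nonnegative. -/
lemma pairCount_nonneg (F : Finset E) (z : Config E) (Φ : Config E → Config E → R)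
    (hΦ : ∀ y w, 0 ≤ Φ y w) : 0 ≤ pairCount F z Φ := by
  unfold pairCount
  refine Finset.sum_nonneg fun y _ => ?_
  split_ifs
  · exact hΦ _ _
  · exact le_rfl

omit [LinearOrder R] [IsStrictOrderedRing R] in
/-- **The folded form of the (TB14) slack**:
`N(Q∩B, Q∩A) − N(Q∩A∩B, Q) = Σ_y 1_Q(y) 1_Q(ȳ) 1[b ∈ C_y(a₁)] (1[o ∈ C_ȳ(a₂)] − 1[o ∈ C_y(a₂)])`. -/
lemma tb14_slack_eq (ends : E → Sym2 V) (a₁ a₂ b o : V) (F : Finset E) (z : Config E) :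
    pairCount F z (crossBO ends a₁ a₂ b o : Config E → Config E → R) -
        pairCount F z (sameBO ends a₁ a₂ b o) =
      pairCount F z (fun y w => iQ ends a₁ a₂ y * iQ ends a₁ a₂ w * iL ends a₁ b y *
        (iH ends a₂ o w - iH ends a₂ o y)) := by
  rw [pairCount_swap F z (crossBO ends a₁ a₂ b o), ← pairCount_sub]
  congr 1
  funext y w
  simp only [crossBO, sameBO]
  ring

omit [LinearOrder R] [IsStrictOrderedRing R] in
/-- **Relabelling**: the (TB14) slack of the marking `(a₂, a₁, o, b)` is the slack of
`(a₁, a₂, b, o)` (the «same» kernels agree, the «cross» kernels are exchanged copies). -/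
lemma tb14_slack_relabel (ends : E → Sym2 V) (a₁ a₂ b o : V) (F : Finset E) (z : Config E) :
    pairCount F z (crossBO ends a₂ a₁ o b : Config E → Config E → R) -
        pairCount F z (sameBO ends a₂ a₁ o b) =
      pairCount F z (crossBO ends a₁ a₂ b o : Config E → Config E → R) -
        pairCount F z (sameBO ends a₁ a₂ b o) := by
  have h1 : (sameBO ends a₂ a₁ o b : Config E → Config E → R) = sameBO ends a₁ a₂ b o := by
    funext y w
    simp only [sameBO, iQ_symm', iL, iH]
    ring
  have h2 : (crossBO ends a₂ a₁ o b : Config E → Config E → R) =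
      fun y w => crossBO ends a₁ a₂ b o w y := by
    funext y w
    simp only [crossBO, iQ_symm', iL, iH]
    ring
  rw [h1, h2, ← pairCount_swap]

end Counts

/-! ## Mark events across the cut -/

section Cross

variable {V : Type*} {E : Type*} {ends : E → Sym2 V} {c : V} {VA VB : Set V} {EA EB : Set E}
  [DecidablePred (· ∈ EA)] [DecidablePred (· ∈ EB)] {R : Type*} [Field R]

/-- For `a ∈ VA` and `v ∈ VB`: `1[v ∈ C(a)] = 1[c ∈ C(a)] · 1[v ∈ C(c)]`. -/
lemma iL_cross (h : IsCut ends c VA VB EA EB) {a v : V} (ha : a ∈ VA) (hv : v ∈ VB)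
    (y : Config E) : (iL ends a v y : R) = iL ends a c y * iL ends c v y := by
  classical
  rw [iL_eq_ite', iL_eq_ite', iL_eq_ite']
  have key : Conn ends y a v ↔ Conn ends y a c ∧ Conn ends y c v := by
    rw [conn_across_iff h ha hv, ← conn_iff_restrict h (Or.inl ha) (Or.inr rfl),
      ← conn_iff_restrict h.symm (Or.inr rfl) (Or.inl hv)]
  by_cases h1 : Conn ends y a c <;> by_cases h2 : Conn ends y c v <;> simp [key, h1, h2]

/-- For `a ∈ VB` and `v ∈ VA`: `1[v ∈ C(a)] = 1[c ∈ C(a)] · 1[v ∈ C(c)]` (`iH` vocabulary). -/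
lemma iH_cross (h : IsCut ends c VA VB EA EB) {a v : V} (ha : a ∈ VB) (hv : v ∈ VA)
    (y : Config E) : (iH ends a v y : R) = iH ends a c y * iH ends c v y :=
  iL_cross h.symm ha hv y

end Cross

/-! ## The three remaining placements -/

section Main

variable {V : Type} {E : Type} [Fintype E] [DecidableEq E] {ends : E → Sym2 V} {c : V}
  {VA VB : Set V} {EA EB : Set E} [DecidablePred (· ∈ EA)] [DecidablePred (· ∈ EB)]
  {R : Type*} [Field R] [LinearOrder R] [IsStrictOrderedRing R]

/-- **Both marks on the side of `a₂`**: typed BHK 1.4 on the instance follows from typed BHK 1.4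
on the side `B` with roots `(c, a₂)`; the rest is p5's half-conditioned theorem on the side `B`
and two nonnegative `A`-side counts. -/
theorem tb14_of_cut_sideB (h : IsCut ends c VA VB EA EB) {a₁ a₂ b o : V} (ha₁ : a₁ ∈ VA)
    (ha₂ : a₂ ∈ VB) (hb : b ∈ VB) (ho : o ∈ VB) (F : Finset E) (z : Config E)
    (hB : pairCount (sideFree EB F) (restrict EB z) (sameBO ends c a₂ b o : Config E → Config E → R) ≤
      pairCount (sideFree EB F) (restrict EB z) (crossBO ends c a₂ b o)) :
    pairCount F z (sameBO ends a₁ a₂ b o : Config E → Config E → R) ≤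
      pairCount F z (crossBO ends a₁ a₂ b o) := by
  rw [← sub_nonneg, tb14_slack_eq]
  -- side invariances
  have hs : ∀ u : Config E, (iL ends a₁ c (restrict EA u) : R) = iL ends a₁ c u :=
    iL_restrict_EA h (Or.inl ha₁) (Or.inr rfl)
  have hρ : ∀ u : Config E, (iL ends c b (restrict EB u) : R) = iL ends c b u := fun u =>
    iH_restrict_EB h (Or.inr rfl) (Or.inl hb) u
  have hh : ∀ u : Config E, (iH ends a₂ o (restrict EB u) : R) = iH ends a₂ o u :=
    iH_restrict_EB h (Or.inl ha₂) (Or.inl ho)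
  have ht : ∀ u : Config E, (iH ends a₂ c (restrict EB u) : R) = iH ends a₂ c u :=
    iH_restrict_EB h (Or.inl ha₂) (Or.inr rfl)
  -- the pointwise expansion
  have hpt : ∀ y w : Config E,
      (iQ ends a₁ a₂ y : R) * iQ ends a₁ a₂ w * iL ends a₁ b y *
          (iH ends a₂ o w - iH ends a₂ o y) =
        iL ends a₁ c y * ((1 - iH ends a₂ c y) * iL ends c b y *
            (iH ends a₂ o w - iH ends a₂ o y)) -
          (iL ends a₁ c y * iL ends a₁ c w) * ((1 - iH ends a₂ c y) * iH ends a₂ c w *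
            iL ends c b y * (iH ends a₂ o w - iH ends a₂ o y)) := by
    intro y w
    rw [iQ_eq_cut h ha₁ ha₂ y, iQ_eq_cut h ha₁ ha₂ w, iL_cross h ha₁ hb y]
    have hid := iL_mul_self (R := R) ends a₁ c y
    linear_combination (iL ends a₁ c w * iH ends a₂ c y * iH ends a₂ c w - iH ends a₂ c y) *
      iL ends c b y * (iH ends a₂ o w - iH ends a₂ o y) * hid
  simp_rw [hpt]
  rw [pairCount_sub]
  have e1 := pairCount_mul_of_cut h F z (fun y _ => (iL ends a₁ c y : R))
    (fun y w => (1 - iH ends a₂ c y) * iL ends c b y * (iH ends a₂ o w - iH ends a₂ o y))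
    (by intro y w; simp only [hs]) (by intro y w; simp only [hρ, hh, ht])
  have e2 := pairCount_mul_of_cut h F z (fun y w => (iL ends a₁ c y * iL ends a₁ c w : R))
    (fun y w => (1 - iH ends a₂ c y) * iH ends a₂ c w * iL ends c b y *
      (iH ends a₂ o w - iH ends a₂ o y))
    (by intro y w; simp only [hs]) (by intro y w; simp only [hρ, hh, ht])
  rw [e1, e2]
  -- the half form on the side `B`, and the side-`B` slack
  set FB := sideFree EB F
  set zB := restrict EB z
  have hhalf : (0 : R) ≤ pairCount FB zB
      (fun y w => (1 - iH ends a₂ c y) * iL ends c b y * (iH ends a₂ o w - iH ends a₂ o y)) := by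
    have h0 := TypedBHKHalf.pairCount_half (R := R) ends c a₂ b o FB zB
    rw [← sub_nonneg, ← pairCount_sub] at h0
    refine le_of_le_of_eq h0 ?_
    congr 1
    funext y w
    rw [iQ_eq_one_sub_iH]
    ring
  have hslack : pairCount FB zB
      (fun y w => (1 - iH ends a₂ c y) * (1 - iH ends a₂ c w) * iL ends c b y *
        (iH ends a₂ o w - iH ends a₂ o y)) =
      pairCount FB zB (crossBO ends c a₂ b o : Config E → Config E → R) -
        pairCount FB zB (sameBO ends c a₂ b o) := by
    rw [tb14_slack_eq]
    congr 1
    funext y w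
    rw [iQ_eq_one_sub_iH, iQ_eq_one_sub_iH]
  -- `X = HALF − D_B`
  have hX : pairCount FB zB
      (fun y w => (1 - iH ends a₂ c y) * iH ends a₂ c w * iL ends c b y *
        (iH ends a₂ o w - iH ends a₂ o y)) =
      pairCount FB zB
        (fun y w => (1 - iH ends a₂ c y) * iL ends c b y * (iH ends a₂ o w - iH ends a₂ o y)) -
      (pairCount FB zB (crossBO ends c a₂ b o : Config E → Config E → R) -
        pairCount FB zB (sameBO ends c a₂ b o)) := by
    rw [← hslack, ← pairCount_sub]
    congr 1
    funext y w
    ring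
  rw [hX]
  -- `D = N_A(c ∈ C∖C') · HALF + N_A(c ∈ C∩C') · D_B`
  have hsplit : pairCount (sideFree EA F) (restrict EA z) (fun y _ => (iL ends a₁ c y : R)) =
      pairCount (sideFree EA F) (restrict EA z)
          (fun y w => iL ends a₁ c y * (1 - iL ends a₁ c w)) +
        pairCount (sideFree EA F) (restrict EA z) (fun y w => iL ends a₁ c y * iL ends a₁ c w) := by
    rw [← pairCount_add]
    congr 1
    funext y w
    ring
  rw [hsplit]
  have hD : (0 : R) ≤ pairCount FB zB (crossBO ends c a₂ b o : Config E → Config E → R) -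
      pairCount FB zB (sameBO ends c a₂ b o) := sub_nonneg.2 hB
  have hn1 : (0 : R) ≤ pairCount (sideFree EA F) (restrict EA z)
      (fun y w => iL ends a₁ c y * (1 - iL ends a₁ c w)) :=
    pairCount_nonneg _ _ _ fun y w => mul_nonneg (iL_nonneg'' ends a₁ c y)
      (sub_nonneg.2 (iL_le_one ends a₁ c w))
  have hn2 : (0 : R) ≤ pairCount (sideFree EA F) (restrict EA z)
      (fun y w => iL ends a₁ c y * iL ends a₁ c w) :=
    pairCount_nonneg _ _ _ fun y w => mul_nonneg (iL_nonneg'' ends a₁ c y) (iL_nonneg'' ends a₁ c w)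
  nlinarith [mul_nonneg hn1 hhalf, mul_nonneg hn2 hD]

/-- **Both marks on the side of `a₁`**: the mirror image of `tb14_of_cut_sideB` under the
relabelling `(a₁, a₂, b, o) ↦ (a₂, a₁, o, b)`; typed BHK 1.4 on the instance follows from typed
BHK 1.4 on the side `A` with roots `(a₁, c)`. -/
theorem tb14_of_cut_sideA (h : IsCut ends c VA VB EA EB) {a₁ a₂ b o : V} (ha₁ : a₁ ∈ VA)
    (ha₂ : a₂ ∈ VB) (hb : b ∈ VA) (ho : o ∈ VA) (F : Finset E) (z : Config E)
    (hA : pairCount (sideFree EA F) (restrict EA z) (sameBO ends a₁ c b o : Config E → Config E → R) ≤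
      pairCount (sideFree EA F) (restrict EA z) (crossBO ends a₁ c b o)) :
    pairCount F z (sameBO ends a₁ a₂ b o : Config E → Config E → R) ≤
      pairCount F z (crossBO ends a₁ a₂ b o) := by
  rw [← sub_nonneg, ← tb14_slack_relabel, sub_nonneg]
  refine tb14_of_cut_sideB h.symm ha₂ ha₁ ho hb F z ?_
  rw [← sub_nonneg, tb14_slack_relabel, sub_nonneg]
  exact hA

/-- **The marks crossed** (`b` on the side of `a₂`, `o` on the side of `a₁`): the slack is a
single product of two nonnegative side counts, `N_A(c ∈ C(a₁) ∖ C'(a₁), o ∈ C'(c)) ·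
N_B(c ∈ C'(a₂) ∖ C(a₂), b ∈ C(c))`, hence typed BHK 1.4 holds unconditionally. -/
theorem tb14_of_cut_crossed (h : IsCut ends c VA VB EA EB) {a₁ a₂ b o : V} (ha₁ : a₁ ∈ VA)
    (ha₂ : a₂ ∈ VB) (hb : b ∈ VB) (ho : o ∈ VA) (F : Finset E) (z : Config E) :
    pairCount F z (sameBO ends a₁ a₂ b o : Config E → Config E → R) ≤
      pairCount F z (crossBO ends a₁ a₂ b o) := by
  rw [← sub_nonneg, tb14_slack_eq]
  have hs : ∀ u : Config E, (iL ends a₁ c (restrict EA u) : R) = iL ends a₁ c u :=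
    iL_restrict_EA h (Or.inl ha₁) (Or.inr rfl)
  have hκ : ∀ u : Config E, (iH ends c o (restrict EA u) : R) = iH ends c o u := fun u =>
    iL_restrict_EA h (Or.inr rfl) (Or.inl ho) u
  have hρ : ∀ u : Config E, (iL ends c b (restrict EB u) : R) = iL ends c b u := fun u =>
    iH_restrict_EB h (Or.inr rfl) (Or.inl hb) u
  have ht : ∀ u : Config E, (iH ends a₂ c (restrict EB u) : R) = iH ends a₂ c u :=
    iH_restrict_EB h (Or.inl ha₂) (Or.inr rfl)
  have hpt : ∀ y w : Config E,
      (iQ ends a₁ a₂ y : R) * iQ ends a₁ a₂ w * iL ends a₁ b y *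
          (iH ends a₂ o w - iH ends a₂ o y) =
        (iL ends a₁ c y * (1 - iL ends a₁ c w) * iH ends c o w) *
          ((1 - iH ends a₂ c y) * iH ends a₂ c w * iL ends c b y) := by
    intro y w
    rw [iQ_eq_cut h ha₁ ha₂ y, iQ_eq_cut h ha₁ ha₂ w, iL_cross h ha₁ hb y, iH_cross h ha₂ ho y,
      iH_cross h ha₂ ho w]
    have hss := iL_mul_self (R := R) ends a₁ c y
    have htt : (iH ends a₂ c y : R) * iH ends a₂ c y = iH ends a₂ c y := iL_mul_self ends a₂ c y
    have htw : (iH ends a₂ c w : R) * iH ends a₂ c w = iH ends a₂ c w := iL_mul_self ends a₂ c w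
    linear_combination
      (-(iL ends a₁ c y * iL ends a₁ c w * iL ends c b y * iH ends c o w *
          (1 - iL ends a₁ c y * iH ends a₂ c y))) * htw +
      (-((1 - iL ends a₁ c w) * iH ends a₂ c w * iL ends c b y * iH ends c o w * iH ends a₂ c y) +
          iL ends c b y * iH ends c o y * (1 - iL ends a₁ c w * iH ends a₂ c w) *
            (iH ends a₂ c y * iH ends a₂ c y)) * hss +
      (iL ends c b y * iH ends c o y * (1 - iL ends a₁ c w * iH ends a₂ c w) * iL ends a₁ c y) * htt
  simp_rw [hpt]
  rw [pairCount_mul_of_cut h F z _ _ (fun y w => by simp only [hs, hκ])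
    (fun y w => by simp only [hρ, ht])]
  refine mul_nonneg (pairCount_nonneg _ _ _ fun y w => ?_) (pairCount_nonneg _ _ _ fun y w => ?_)
  · exact mul_nonneg (mul_nonneg (iL_nonneg'' ends a₁ c y) (sub_nonneg.2 (iL_le_one ends a₁ c w)))
      (iL_nonneg'' ends c o w)
  · exact mul_nonneg (mul_nonneg (sub_nonneg.2 (iL_le_one ends a₂ c y)) (iL_nonneg'' ends a₂ c w))
      (iL_nonneg'' ends c b y)

/-- **Typed BHK 1.4 across a root-separating cut vertex, all placements of the marks**: if an
unmarked cut vertex `c` separates `a₁` from `a₂`, typed BHK 1.4 at the profile `(F, z)` follows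
from typed BHK 1.4 on the side `A` with roots `(a₁, c)` and on the side `B` with roots `(c, a₂)`
(at the side profiles, with the same marks). -/
theorem tb14_of_cut (h : IsCut ends c VA VB EA EB) {a₁ a₂ b o : V} (ha₁ : a₁ ∈ VA)
    (ha₂ : a₂ ∈ VB) (hb : b ∈ VA ∨ b ∈ VB) (ho : o ∈ VA ∨ o ∈ VB) (F : Finset E) (z : Config E)
    (hA : pairCount (sideFree EA F) (restrict EA z) (sameBO ends a₁ c b o : Config E → Config E → R) ≤
      pairCount (sideFree EA F) (restrict EA z) (crossBO ends a₁ c b o))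
    (hB : pairCount (sideFree EB F) (restrict EB z) (sameBO ends c a₂ b o : Config E → Config E → R) ≤
      pairCount (sideFree EB F) (restrict EB z) (crossBO ends c a₂ b o)) :
    pairCount F z (sameBO ends a₁ a₂ b o : Config E → Config E → R) ≤
      pairCount F z (crossBO ends a₁ a₂ b o) := by
  rcases hb with hb | hb <;> rcases ho with ho | ho
  · exact tb14_of_cut_sideA h ha₁ ha₂ hb ho F z hA
  · exact tb14_of_cut_opposite h ha₁ hb ha₂ ho F z
  · exact tb14_of_cut_crossed h ha₁ ha₂ hb ho F z
  · exact tb14_of_cut_sideB h ha₁ ha₂ hb ho F z hB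

end Main

end TB14Cut

end Summit.Ventures.PercRepro2
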